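import Summits.ABC.IUTFork.Cor312VolumesRealAssembly
import Summits.ABC.IUTFork.Cor312ThetaAdmFrames
import Summits.ABC.IUTFork.Cor312LogKummerGlobal
import HarnessLib

/-!
# [IUTchIII] Cor. 3.12, TEAM B — the capstone AT THE ASSEMBLED REAL SETTING: `Statement` from the
# global (xi-g) input + Kummer-realisation data + the four finiteness residuals, over `situationDHVol`

Record-only file (D-0012) of the abc-iut cell (Cor. 3.12 strategy TEAM B «estimate / log-Kummer» of
HUMAN RULING D-0067 (3), seat abc-iut-c312-12 = B2, gen 2; the "real-model derivation attempt over the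
assembled setting" step named open for Teams A+B in GAP-LEDGER row G-c312-9-1-SUPPLEMENT and in B1's
RESULT kit residual list); PROOF-ONLY; TAKES NO SIDE. The abstract TEAM B capstones
(`teamB_capstone_of_latticeRealisations` p413800, `teamB_capstone_global_of_latticeRealisations`
p414562, summands twin p414525) take the container/realisation INSTANCE DATA as hypotheses. At the
ASSEMBLED real setting — any c312-7 `Cor312.Setting` over abc-iut-c312-5's
`Thm311.Real.situationDHVol` (the situation of Thm. 3.11 over the real Dupuy–Hilado-level log-shells
with the VERBATIM all-places container, `Cor312VolumesRealAssembly`) — part of that data is a THEOREM: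
the line realises the container (`realizes_situationDHVol`) and the (Ind1)/(Ind2) generators preserve
it (`generatorsPreserve_summandPiecesDH`). This file records the resulting SHORTENED residual list:

* `Real.teamB_statement_of_globalVolumeTransport_DH` — for `P` over `situationDHVol`, **the printed
  `Statement` of Cor. 3.12 follows from**: (1) KUMMER-REALISATION DATA over the verbatim container —
  each `m`-th Kummer isomorphism realised by a container-preserving `Ψm m` (abc-iut-c312-5
  `SummandPieces.PreservesRegions`), the `m`-th Θ-Kummer images the `Ψm m`-transports of ONE admissible
  reference region ([IUTchIII] Thm. 3.11 (ii) (a), Prop. 3.1 (ii); Dupuy–Hilado §4.7) — the residual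
  obligations `hΨ`/`hthetaEq`/`hR` of B1's RESULT-kit list (the `hAdm`-iff reading of the single-Haar
  criteria p411395/p413177 is NOT needed here: the container is realised, not read); (2) the four named
  finiteness residuals `hθ`/`hfin`/`hul_nonempty`/`ThetaFinite` of c312-5's `bridgeHyps_DH`; and
  (3) **`Cor312Vol.GlobalVolumeTransport P`** — THE GAP input at the print's global quantifier level
  (G-c312-11-1-SUPPLEMENT, kurims p. 184 l. 30–34), never asserted. Composition of c312-5's
  `bridgeHyps_DH`, c312-6's `thetaRegionsAdm_of_preservesRegions` (p413564) fed with
  `realizes_situationDHVol`, and B1's `GlobalVolumeTransport.statement_of` (p414039). Uniform variant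
  `…At_DH` (`m₀ = 0` is the print's (xi-a) gluing position); per-packet variant
  `teamB_statement_of_volumeTransport_DH` (route's `≤`/`∃ m` form, support condition DERIVED via
  p414039's `globalVolumeTransport_of_volumeTransport`).
* Bookkeeping at the assembly: `volumeTransport_iff_at_zero_DH` (the `∃ m` of the per-packet B-INPUT
  collapses to the gluing position `m = 0`), `logvol_thetaRegion_eq_ref_DH` (every single Kummer image
  has EXACTLY the reference region's log-volume — Thm. 3.11 (ii)'s "[precisely!]" clause / Prop. 3.9
  (iv) at the real container).

What remains open at the real model after this file, exactly: the Kummer-realisation data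
`hΨ`/`hthetaEq`/`hR` for the PRINTED Kummer isomorphisms and Θ-pilot regions at the real carriers
(abc-iut-c312-3 W2-G / c312-5 `Real.*` instance claim; `PreservesRegions.summandwise` is the entry
point), the four finiteness residuals, and THE GAP. Sources read on the page (kurims
`paper:url-4b091feeb646`): [IUTchIII] pp. 94–96 (Rmk. 3.1.1 (ii)(iii)), p. 92 (Prop. 3.1 (ii)),
pp. 115–117 (Prop. 3.9 (i)(iv)), pp. 155–156 (Thm. 3.11 (ii)), pp. 173–174 (Cor. 3.12 statement),
p. 184 ((xi-g)). [claim: Mochizuki2012, status: disputed] [cite: DupuyHilado2025, §4.7]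
NO new definition, NO new `Prop`; nothing asserted about the gap input; no judgement on Cor. 3.12.
Deliberately NOT here: the instance data themselves (c312-3/c312-5), the single-Haar `hAdm`-iff
readings (not needed on this route), the archimedean radial container (the assembly's recorded
modelling choice), any side on whether `GlobalVolumeTransport` holds.
-/

noncomputable section

open Set Function NumberField

namespace Summit.ABC

namespace IUTFork

namespace Thm311

namespace Real

open Cor312 Cor312Vol Literature.IUT.LogThetaLattice Literature.IUT.LogVolume

variable {F : Type} [Field F] [NumberField F] (X : PilotData F) {logv : PadicLogs F}
  (hlog : LogvAnalytic logv) (M : Type) [Field M] [NumberField M]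
  (archPk : ∀ (j : (thetaIndex X).Label) (vQ : (thetaIndex X).VQ),
    Set ((logShellsDH X logv).Packet j vQ))
  (archSub : ∀ (j : (thetaIndex X).Label) (v : (thetaIndex X).V),
    Set ((logShellsDH X logv).Packet j ((thetaIndex X).over v)))
  (Ψ : ℤ → ∀ v : (thetaIndex X).V, v ∈ (thetaIndex X).Vbad → Set ((logShellsDH X logv).StarPacket v))
  (act : ℤ → ∀ v : (thetaIndex X).V, v ∈ (thetaIndex X).Vbad →
    (logShellsDH X logv).StarPacket v → Module.End ℚ ((logShellsDH X logv).StarPacket v))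
  (Mmod : ℤ → ∀ j : (thetaIndex X).LabelStar, Set ((logShellsDH X logv).GlobalPacket j.1))
  (region : ℤ → ∀ j : (thetaIndex X).LabelStar, FinDivisor M → ∀ vQ : (thetaIndex X).VQ,
    Set ((logShellsDH X logv).Packet j.1 vQ))
  (P : Cor312.Setting (situationDHVol X hlog M archPk archSub Ψ act Mmod region))
  (Ψm : ℤ → ∀ (j : (thetaIndex X).Label) (vQ : (thetaIndex X).VQ),
    (∀ e, (summandPiecesDH X hlog).X j vQ e) → ∀ e, (summandPiecesDH X hlog).X j vQ e)
  (R : ∀ (j : (thetaIndex X).Label) (vQ : (thetaIndex X).VQ),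
    Set ((logShellsDH X logv).Packet j vQ))

/-- **`ThetaRegionsAdm` AT THE ASSEMBLED REAL SETTING**: for a `Cor312.Setting` over
`situationDHVol`, if each `m`-th Kummer isomorphism is realised on the verbatim all-places container by
a container-preserving `Ψm m` and the `m`-th Θ-Kummer images are the `Ψm m`-transports of ONE admissible
reference region, then every single Kummer image of the Θ-pilot object is admissible — c312-6's
criterion (p413564) fed with `realizes_situationDHVol`; the `hV` of the abstract form is a THEOREM
here. [claim: Mochizuki2012, status: disputed] -/
theorem thetaRegionsAdm_DH
    (hΨ : ∀ (m : ℤ) (j : (thetaIndex X).Label) (vQ : (thetaIndex X).VQ),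
      (summandPiecesDH X hlog).PreservesRegions j vQ (Ψm m j vQ))
    (hthetaEq : ∀ (m : ℤ) (i : Fin (thetaIndex X).lstar) (vQ : (thetaIndex X).VQ),
      (summandPiecesDH X hlog).e (Setting.labelSucc i) vQ ''
          P.thetaRegion m (Setting.labelSucc i) vQ =
        Ψm m (Setting.labelSucc i) vQ '' ((summandPiecesDH X hlog).e (Setting.labelSucc i) vQ ''
          R (Setting.labelSucc i) vQ))
    (hR : ∀ (i : Fin (thetaIndex X).lstar) (vQ : (thetaIndex X).VQ),
      (summandPiecesDH X hlog).Adm (Setting.labelSucc i) vQ (R (Setting.labelSucc i) vQ)) :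
    ThetaRegionsAdm P :=
  (summandPiecesDH X hlog).thetaRegionsAdm_of_preservesRegions P Ψm R
    (realizes_situationDHVol X hlog M archPk archSub Ψ act Mmod region P.n) hΨ hthetaEq hR

/-- **TEAM B CAPSTONE AT THE ASSEMBLED REAL SETTING (global form)** — the printed `Statement` of
[IUTchIII] Cor. 3.12, for any `Cor312.Setting` over `situationDHVol`, from (1) Kummer-realisation data
over the verbatim container (`hΨ`/`hthetaEq`/`hR`), (2) the four named finiteness residuals
(`hθ`/`hfin`/`hul_nonempty`/`finite`), and (3) THE GAP input `Cor312Vol.GlobalVolumeTransport P`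
(G-c312-11-1-SUPPLEMENT, kurims p. 184 l. 30–34) — `hV`/`hG` of the abstract capstones are THEOREMS
here (`realizes_situationDHVol`, `generatorsPreserve_summandPiecesDH`), so the residual side-condition
list at the real model is exactly (1)+(2)+(3). NOTHING asserted about (3); whether it follows from the
frozen FACT LIST is the adjudication. [claim: Mochizuki2012, status: disputed] -/
theorem teamB_statement_of_globalVolumeTransport_DH
    (hΨ : ∀ (m : ℤ) (j : (thetaIndex X).Label) (vQ : (thetaIndex X).VQ),
      (summandPiecesDH X hlog).PreservesRegions j vQ (Ψm m j vQ))
    (hthetaEq : ∀ (m : ℤ) (i : Fin (thetaIndex X).lstar) (vQ : (thetaIndex X).VQ),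
      (summandPiecesDH X hlog).e (Setting.labelSucc i) vQ ''
          P.thetaRegion m (Setting.labelSucc i) vQ =
        Ψm m (Setting.labelSucc i) vQ '' ((summandPiecesDH X hlog).e (Setting.labelSucc i) vQ ''
          R (Setting.labelSucc i) vQ))
    (hR : ∀ (i : Fin (thetaIndex X).lstar) (vQ : (thetaIndex X).VQ),
      (summandPiecesDH X hlog).Adm (Setting.labelSucc i) vQ (R (Setting.labelSucc i) vQ))
    (hθ : ∀ (i : Fin (thetaIndex X).lstar) (vQ : (thetaIndex X).VQ),
      ((situationDHVol X hlog M archPk archSub Ψ act Mmod region).D P.n).Adm _ vQ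
        (P.thetaRegion3 (Setting.labelSucc i) vQ))
    (hfin : ∀ i : Fin (thetaIndex X).lstar, (Function.support fun vQ : (thetaIndex X).VQ =>
      ((situationDHVol X hlog M archPk archSub Ψ act Mmod region).D P.n).logvol _ vQ
        (P.thetaRegion3 (Setting.labelSucc i) vQ)).Finite)
    (hul_nonempty : ∀ (j : (thetaIndex X).Label) (vQ : (thetaIndex X).VQ),
      ∀ H ∈ (P.frame j vQ).Hul, H.Nonempty)
    (finite : P.ThetaFinite)
    (hgvt : GlobalVolumeTransport P) : P.Statement :=
  hgvt.statement_of
    (bridgeHyps_DH X hlog M archPk archSub Ψ act Mmod region P hθ hfin hul_nonempty finite)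
    (thetaRegionsAdm_DH X hlog M archPk archSub Ψ act Mmod region P Ψm R hΨ hthetaEq hR)

/-- The uniform variant: the global comparison at ONE lattice position — `m₀ = 0` is the print's
(xi-a) gluing position — suffices at the assembled real setting.
[claim: Mochizuki2012, status: disputed] -/
theorem teamB_statement_of_globalVolumeTransportAt_DH
    (hΨ : ∀ (m : ℤ) (j : (thetaIndex X).Label) (vQ : (thetaIndex X).VQ),
      (summandPiecesDH X hlog).PreservesRegions j vQ (Ψm m j vQ))
    (hthetaEq : ∀ (m : ℤ) (i : Fin (thetaIndex X).lstar) (vQ : (thetaIndex X).VQ),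
      (summandPiecesDH X hlog).e (Setting.labelSucc i) vQ ''
          P.thetaRegion m (Setting.labelSucc i) vQ =
        Ψm m (Setting.labelSucc i) vQ '' ((summandPiecesDH X hlog).e (Setting.labelSucc i) vQ ''
          R (Setting.labelSucc i) vQ))
    (hR : ∀ (i : Fin (thetaIndex X).lstar) (vQ : (thetaIndex X).VQ),
      (summandPiecesDH X hlog).Adm (Setting.labelSucc i) vQ (R (Setting.labelSucc i) vQ))
    (hθ : ∀ (i : Fin (thetaIndex X).lstar) (vQ : (thetaIndex X).VQ),
      ((situationDHVol X hlog M archPk archSub Ψ act Mmod region).D P.n).Adm _ vQ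
        (P.thetaRegion3 (Setting.labelSucc i) vQ))
    (hfin : ∀ i : Fin (thetaIndex X).lstar, (Function.support fun vQ : (thetaIndex X).VQ =>
      ((situationDHVol X hlog M archPk archSub Ψ act Mmod region).D P.n).logvol _ vQ
        (P.thetaRegion3 (Setting.labelSucc i) vQ)).Finite)
    (hul_nonempty : ∀ (j : (thetaIndex X).Label) (vQ : (thetaIndex X).VQ),
      ∀ H ∈ (P.frame j vQ).Hul, H.Nonempty)
    (finite : P.ThetaFinite)
    {m₀ : ℤ} (hgvt : GlobalVolumeTransportAt P m₀) : P.Statement :=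
  teamB_statement_of_globalVolumeTransport_DH X hlog M archPk archSub Ψ act Mmod region P Ψm R
    hΨ hthetaEq hR hθ hfin hul_nonempty finite (globalVolumeTransport_of_at hgvt)

/-- The per-packet variant: the route's `≤`/`∃ m` form `VolumeTransport P` (flagged
STRONGER-THAN-PRINT, G-c312-11-1-SUPPLEMENT) also gives the `Statement` at the assembled real setting —
the finite-support side condition of the global form is DERIVED (p414039's
`globalVolumeTransport_of_volumeTransport`), not assumed. [claim: Mochizuki2012, status: disputed] -/
theorem teamB_statement_of_volumeTransport_DH
    (hΨ : ∀ (m : ℤ) (j : (thetaIndex X).Label) (vQ : (thetaIndex X).VQ),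
      (summandPiecesDH X hlog).PreservesRegions j vQ (Ψm m j vQ))
    (hthetaEq : ∀ (m : ℤ) (i : Fin (thetaIndex X).lstar) (vQ : (thetaIndex X).VQ),
      (summandPiecesDH X hlog).e (Setting.labelSucc i) vQ ''
          P.thetaRegion m (Setting.labelSucc i) vQ =
        Ψm m (Setting.labelSucc i) vQ '' ((summandPiecesDH X hlog).e (Setting.labelSucc i) vQ ''
          R (Setting.labelSucc i) vQ))
    (hR : ∀ (i : Fin (thetaIndex X).lstar) (vQ : (thetaIndex X).VQ),
      (summandPiecesDH X hlog).Adm (Setting.labelSucc i) vQ (R (Setting.labelSucc i) vQ))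
    (hθ : ∀ (i : Fin (thetaIndex X).lstar) (vQ : (thetaIndex X).VQ),
      ((situationDHVol X hlog M archPk archSub Ψ act Mmod region).D P.n).Adm _ vQ
        (P.thetaRegion3 (Setting.labelSucc i) vQ))
    (hfin : ∀ i : Fin (thetaIndex X).lstar, (Function.support fun vQ : (thetaIndex X).VQ =>
      ((situationDHVol X hlog M archPk archSub Ψ act Mmod region).D P.n).logvol _ vQ
        (P.thetaRegion3 (Setting.labelSucc i) vQ)).Finite)
    (hul_nonempty : ∀ (j : (thetaIndex X).Label) (vQ : (thetaIndex X).VQ),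
      ∀ H ∈ (P.frame j vQ).Hul, H.Nonempty)
    (finite : P.ThetaFinite)
    (hvt : VolumeTransport P) : P.Statement :=
  have H := bridgeHyps_DH X hlog M archPk archSub Ψ act Mmod region P hθ hfin hul_nonempty finite
  have hadm := thetaRegionsAdm_DH X hlog M archPk archSub Ψ act Mmod region P Ψm R hΨ hthetaEq hR
  (globalVolumeTransport_of_volumeTransport H hadm hvt).statement_of H hadm

/-- Bookkeeping at the assembly: under the realisation data the `∃ m` of the per-packet B-INPUT
collapses to the print's gluing position — `VolumeTransport P ↔ VolumeTransportAt P 0` (c312-6's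
criterion at the real container). The adjudication target is ONE comparison per packet.
[claim: Mochizuki2012, status: disputed] -/
theorem volumeTransport_iff_at_zero_DH
    (hΨ : ∀ (m : ℤ) (j : (thetaIndex X).Label) (vQ : (thetaIndex X).VQ),
      (summandPiecesDH X hlog).PreservesRegions j vQ (Ψm m j vQ))
    (hthetaEq : ∀ (m : ℤ) (i : Fin (thetaIndex X).lstar) (vQ : (thetaIndex X).VQ),
      (summandPiecesDH X hlog).e (Setting.labelSucc i) vQ ''
          P.thetaRegion m (Setting.labelSucc i) vQ =
        Ψm m (Setting.labelSucc i) vQ '' ((summandPiecesDH X hlog).e (Setting.labelSucc i) vQ ''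
          R (Setting.labelSucc i) vQ))
    (hR : ∀ (i : Fin (thetaIndex X).lstar) (vQ : (thetaIndex X).VQ),
      (summandPiecesDH X hlog).Adm (Setting.labelSucc i) vQ (R (Setting.labelSucc i) vQ)) :
    VolumeTransport P ↔ VolumeTransportAt P 0 :=
  (summandPiecesDH X hlog).volumeTransport_iff_at_of_preservesRegions P Ψm R
    (realizes_situationDHVol X hlog M archPk archSub Ψ act Mmod region P.n) hΨ hthetaEq hR 0

/-- Bookkeeping at the assembly: every single Kummer image of the Θ-pilot object has EXACTLY the
reference region's log-volume (Thm. 3.11 (ii)'s "[precisely!]" clause / Prop. 3.9 (iv) at the verbatim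
real container) — in particular the single-image volumes are `m`-independent.
[claim: Mochizuki2012, status: disputed] -/
theorem logvol_thetaRegion_eq_ref_DH
    (hΨ : ∀ (m : ℤ) (j : (thetaIndex X).Label) (vQ : (thetaIndex X).VQ),
      (summandPiecesDH X hlog).PreservesRegions j vQ (Ψm m j vQ))
    (hthetaEq : ∀ (m : ℤ) (i : Fin (thetaIndex X).lstar) (vQ : (thetaIndex X).VQ),
      (summandPiecesDH X hlog).e (Setting.labelSucc i) vQ ''
          P.thetaRegion m (Setting.labelSucc i) vQ =
        Ψm m (Setting.labelSucc i) vQ '' ((summandPiecesDH X hlog).e (Setting.labelSucc i) vQ ''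
          R (Setting.labelSucc i) vQ))
    (hR : ∀ (i : Fin (thetaIndex X).lstar) (vQ : (thetaIndex X).VQ),
      (summandPiecesDH X hlog).Adm (Setting.labelSucc i) vQ (R (Setting.labelSucc i) vQ))
    (m : ℤ) (i : Fin (thetaIndex X).lstar) (vQ : (thetaIndex X).VQ) :
    ((situationDHVol X hlog M archPk archSub Ψ act Mmod region).D P.n).logvol
        (Setting.labelSucc i) vQ (P.thetaRegion m (Setting.labelSucc i) vQ) =
      ((situationDHVol X hlog M archPk archSub Ψ act Mmod region).D P.n).logvol
        (Setting.labelSucc i) vQ (R (Setting.labelSucc i) vQ) :=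
  (summandPiecesDH X hlog).logvol_thetaRegion_eq_ref_of_preservesRegions P Ψm R
    (realizes_situationDHVol X hlog M archPk archSub Ψ act Mmod region P.n) hΨ hthetaEq hR m i vQ

end Real

end Thm311

end IUTFork

end Summit.ABC

end
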